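import Literature.Geometry.Riemannian.SphericalCylinderEntropy
import Literature.Geometry.Riemannian.LowEntropyHypersurfacesFourProofs
import Literature.Geometry.Riemannian.TiltedSliceEntropy
import HarnessLib

/-!
# `stub_groundStateContinuity` of line `conformal-kernel-domination` is FALSE without its area hypothesis

Crux `CylinderEntropy.SliceIsolation` (`stmt-SmoothPoincare4-7632`), line `conformal-kernel-domination`,
registered stub `stub_groundStateContinuity` (skeleton `Cruxes/SliceIsolation/Lines/conformal-kernel-domination.lean`):
"for all `δ, t₁ > 0` there are `η, ε > 0` such that every measurable end-separating `A ⊆ N = S⁴ × ℝ ⊂ ℝ⁶` in the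
slab of half-height `η` about `t₀` WITH `μH⁴(A) ≤ (1+ε) μH⁴(S⁴)` has all Euclidean Gaussian areas of its conformal
image `Φ(A) ⊂ ℝ⁵` (`Φ(x,s) = eˢx`) at scales `t ≥ t₁ e^{2t₀}` at most `λ(S⁴) + δ`".

This file is a NEGATIVE (tightness) lemma for that stub, written by the deep-refuter of the line: the same statement
with the area hypothesis (and its quantifier `∃ ε > 0`) deleted is false.  Witness: two slices `S⁴ × {0} ∪ S⁴ × {c}`,
`0 < c ≤ min η ½` — measurable, end-separating (it contains a slice), inside the slab — seen from the centre `y = 0`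
at the scale `t = e^{2c}/8 ≥ t₁ = 1/8` matched to the outer sphere: `Φ` maps the two slices onto the round spheres of
radii `1` and `e^{c}`, the outer one alone has Gaussian area `λ(S⁴) = F_{0,r²/8}(S⁴_r)` (Stone / Colding–Minicozzi,
tree `gaussianArea_zero_one_shrinkingSphere` + dilation invariance), and the inner one adds
`e^{-1/(4t)}/(6t²) > 1/10`.  So the area budget is exactly what spreads the mass: it is load-bearing, as designed
(the line's composition feeds it from `measure_ratio_le_cylEntropy`).  Everything is proved; no facts, no definitions.
-/

noncomputable section

open MeasureTheory Set Metric
open scoped ENNReal Topology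

namespace Summit.SmoothPoincare4.SmoothPoincare4.Theorems.SliceIsolation.Negative

open Literature.Geometry.Riemannian
open Literature.Geometry.Manifold.CylinderSlice
open Literature.Geometry.Riemannian.SphericalCylinderEntropy (measurableSet_range_sliceMap)

set_option linter.dupNamespace false



/-- `Φ` on the slice at height `c` is the dilation by `e^{c}`: `Φ(x, c) = e^{c} x`. [folklore] -/
theorem conformal_sliceMap (c : ℝ) (x : (Metric.sphere (0 : EuclideanSpace ℝ (Fin 5)) 1)) :
    (fun z : EuclideanSpace ℝ (Fin 6) =>
  (WithLp.toLp 2 (fun i : Fin 5 => Real.exp (z 5) * z (Fin.castSucc i)) : EuclideanSpace ℝ (Fin 5))) (sliceMap c x) = Real.exp c • (x : EuclideanSpace ℝ (Fin 5)) := by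
  ext i
  simp [sliceMap_apply_castSucc, sliceMap_apply_last]

/-- `Φ` maps the slice `S⁴ × {c}` onto the round sphere of radius `e^{c}` about `0`. [folklore] -/
theorem image_conformal_range_sliceMap (c : ℝ) :
    (fun z : EuclideanSpace ℝ (Fin 6) =>
  (WithLp.toLp 2 (fun i : Fin 5 => Real.exp (z 5) * z (Fin.castSucc i)) : EuclideanSpace ℝ (Fin 5))) '' Set.range (sliceMap c) = Metric.sphere (0 : EuclideanSpace ℝ (Fin 5)) (Real.exp c) := by
  rw [← Set.range_comp]
  have h : ((fun z : EuclideanSpace ℝ (Fin 6) =>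
  (WithLp.toLp 2 (fun i : Fin 5 => Real.exp (z 5) * z (Fin.castSucc i)) : EuclideanSpace ℝ (Fin 5))) ∘ sliceMap c) = (fun v : EuclideanSpace ℝ (Fin 5) => Real.exp c • v) ∘ ((↑) : (Metric.sphere (0 : EuclideanSpace ℝ (Fin 5)) 1) → EuclideanSpace ℝ (Fin 5)) :=
    funext fun x => conformal_sliceMap c x
  rw [h, Set.range_comp, Subtype.range_coe, Set.image_smul, smul_sphere' (Real.exp_pos c).ne',
    smul_zero, Real.norm_eq_abs, abs_of_pos (Real.exp_pos c), mul_one]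

/-- Gaussian areas are additive over a disjoint union with a measurable piece. [folklore] -/
theorem gaussianArea_union_of_disjoint {E : Type*} [NormedAddCommGroup E] [MeasurableSpace E] [BorelSpace E]
    (n : ℕ) (p : E) (t : ℝ) {A B : Set E} (hB : MeasurableSet B) (hAB : Disjoint A B) :
    gaussianArea n p t (A ∪ B) = gaussianArea n p t A + gaussianArea n p t B := by
  rw [gaussianArea_eq, gaussianArea_eq, gaussianArea_eq, lintegral_union hB hAB, mul_add]

/-- The Gaussian area of the unit sphere of `ℝ⁵` centred at the origin, at scale `t > 0`:
`F_{0,t}(S⁴) = (4πt)⁻² e^{-1/(4t)} · 8π²/3`. [folklore] -/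
theorem gaussianArea_unitSphere_center (t : ℝ) (ht : 0 < t) :
    gaussianArea 4 (0 : EuclideanSpace ℝ (Fin 5)) t (Metric.sphere (0 : EuclideanSpace ℝ (Fin 5)) 1) =
      ENNReal.ofReal (((4 * Real.pi * t) ^ 2)⁻¹ * (Real.exp (-1 / (4 * t)) * (8 * Real.pi ^ 2 / 3))) := by
  rw [gaussianArea_eq]
  have hw : ∀ x ∈ Metric.sphere (0 : EuclideanSpace ℝ (Fin 5)) 1,
      gaussianWeight (0 : EuclideanSpace ℝ (Fin 5)) t x = ENNReal.ofReal (Real.exp (-1 / (4 * t))) := by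
    intro x hx
    rw [gaussianWeight, sub_zero, mem_sphere_zero_iff_norm.1 hx, one_pow]
  rw [setLIntegral_congr_fun isClosed_sphere.measurableSet hw, setLIntegral_const,
    Literature.Geometry.Riemannian.TiltedSliceEntropy.euclideanHausdorff_sphere_four,
    ← ENNReal.ofReal_mul (Real.exp_pos _).le, gaussianNormalization,
    ← ENNReal.ofReal_mul (Real.rpow_nonneg (by positivity) _)]
  congr 1
  have h4 : (-((4 : ℕ) : ℝ) / 2) = -(2 : ℝ) := by norm_num
  rw [h4, Real.rpow_neg (by positivity), Real.rpow_two]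

/-- At the scales `t ∈ [1/8, 3/8]` the unit sphere seen from its centre has Gaussian area `> 1/10`. [folklore] -/
theorem tenth_lt_gaussianArea_unitSphere {t : ℝ} (h1 : 1 / 8 ≤ t) (h2 : t ≤ 3 / 8) :
    ENNReal.ofReal (1 / 10) < gaussianArea 4 (0 : EuclideanSpace ℝ (Fin 5)) t (Metric.sphere (0 : EuclideanSpace ℝ (Fin 5)) 1) := by
  have ht : 0 < t := by linarith
  rw [gaussianArea_unitSphere_center t ht, ENNReal.ofReal_lt_ofReal_iff_of_nonneg (by norm_num)]
  -- `e^{-1/(4t)} ≥ e^{-2} > 1/8` and `((4πt)²)⁻¹ · 8π²/3 = 1/(6t²) ≥ 1/(6·(3/8)²)`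
  have hpi := Real.pi_pos
  have he : Real.exp (-2) ≤ Real.exp (-1 / (4 * t)) := by
    apply Real.exp_le_exp.2
    rw [neg_div, neg_le_neg_iff, div_le_iff₀ (by positivity : (0 : ℝ) < 4 * t)]
    linarith
  have he2 : (1 : ℝ) / 8 < Real.exp (-2) := by
    have h1e : Real.exp 1 < 2.7182818286 := Real.exp_one_lt_d9
    have hpos : 0 < Real.exp 1 := Real.exp_pos 1
    have : Real.exp (-2) = ((Real.exp 1) ^ 2)⁻¹ := by
      rw [← Real.exp_nat_mul, Real.exp_neg]; norm_num
    rw [this, lt_inv_comm₀ (by norm_num) (by positivity), one_div, inv_inv]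
    nlinarith
  have hmain : ((4 * Real.pi * t) ^ 2)⁻¹ * (Real.exp (-1 / (4 * t)) * (8 * Real.pi ^ 2 / 3)) =
      Real.exp (-1 / (4 * t)) / (6 * t ^ 2) := by
    field_simp
    ring
  rw [hmain, lt_div_iff₀ (by positivity)]
  nlinarith [he, he2, mul_pos ht ht, h1, h2]

/-- The sphere of radius `e^{c}` about `0`, seen from `0` at the matched scale `e^{2c}/8`, has Gaussian area exactly
`λ(S⁴) = λ(unit S⁴)`. [cite: ColdingMinicozzi2012, Lemma 7.10] -/
theorem gaussianArea_sphere_exp_matched (c : ℝ) :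
    gaussianArea 4 (0 : EuclideanSpace ℝ (Fin 5)) (Real.exp (2 * c) / 8) (Metric.sphere (0 : EuclideanSpace ℝ (Fin 5)) (Real.exp c)) =
      gaussianEntropy 4 (Metric.sphere (0 : EuclideanSpace ℝ (Fin 5)) 1) := by
  have h8 : (0 : ℝ) < Real.sqrt 8 := Real.sqrt_pos.2 (by norm_num)
  set a : ℝ := Real.exp c / Real.sqrt 8 with ha
  have ha0 : 0 < a := div_pos (Real.exp_pos c) h8
  have hV : Module.finrank ℝ (EuclideanSpace ℝ (Fin 5)) = 4 + 1 := by simp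
  have h := gaussianArea_smul ha0.ne' 4 (0 : EuclideanSpace ℝ (Fin 5)) one_pos (Metric.sphere (0 : EuclideanSpace ℝ (Fin 5)) (Real.sqrt (2 * (4 : ℕ))))
  have hs : Real.sqrt (2 * ((4 : ℕ) : ℝ)) = Real.sqrt 8 := by norm_num
  rw [hs, smul_zero, mul_one, smul_sphere' ha0.ne', smul_zero, Real.norm_eq_abs, abs_of_pos ha0] at h
  have h1 : a * Real.sqrt 8 = Real.exp c := by rw [ha, div_mul_cancel₀ _ h8.ne']
  have h2 : a ^ 2 = Real.exp (2 * c) / 8 := by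
    rw [ha, div_pow, Real.sq_sqrt (by norm_num : (0 : ℝ) ≤ 8), two_mul, Real.exp_add, sq]
  rw [h1, h2] at h
  rw [h, ← hs, gaussianArea_zero_one_shrinkingSphere hV (by norm_num),
    gaussianEntropy_sphere_four (0 : EuclideanSpace ℝ (Fin 5)) one_pos, sphereEntropy_four]

/-- **`stub_groundStateContinuity` without its area hypothesis is false.**  The registered statement of the stub
with `μH[4] A ≤ ENNReal.ofReal (1 + ε) * μH[4] (Metric.sphere 0 1)` (and its `∃ ε > 0`) removed; witness: two slices
at heights `0` and `c = min η (1/2)`, centre `y = 0`, scale `e^{2c}/8`, `δ = 1/10`, `t₁ = 1/8`. [folklore] -/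
theorem groundStateContinuity_false_without_area :
    ¬ (∀ δ : ℝ, 0 < δ → ∀ t₁ : ℝ, 0 < t₁ → ∃ η : ℝ, 0 < η ∧
        ∀ (t₀ : ℝ) (A : Set (EuclideanSpace ℝ (Fin 6))),
          A ⊆ {z : EuclideanSpace ℝ (Fin 6) | ∑ i : Fin 5, z (Fin.castSucc i) ^ 2 = 1} →
          MeasurableSet A →
          (∃ R : ℝ, ∀ a b : EuclideanSpace ℝ (Fin 6), ∑ i : Fin 5, a (Fin.castSucc i) ^ 2 = 1 →
              ∑ i : Fin 5, b (Fin.castSucc i) ^ 2 = 1 → a 5 ≤ -R → R ≤ b 5 →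
              ¬ JoinedIn ({z : EuclideanSpace ℝ (Fin 6) | ∑ i : Fin 5, z (Fin.castSucc i) ^ 2 = 1} \ A) a b) →
          (∀ z ∈ A, |z 5 - t₀| ≤ η) →
          ∀ (y : EuclideanSpace ℝ (Fin 5)) (t : ℝ), t₁ * Real.exp (2 * t₀) ≤ t →
            gaussianArea 4 y t ((fun z : EuclideanSpace ℝ (Fin 6) =>
                (WithLp.toLp 2 (fun i : Fin 5 => Real.exp (z 5) * z (Fin.castSucc i)) :
                  EuclideanSpace ℝ (Fin 5))) '' A) ≤
              gaussianEntropy 4 (Metric.sphere (0 : EuclideanSpace ℝ (Fin 5)) 1) + ENNReal.ofReal δ) := by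
  intro h
  obtain ⟨η, hη, H⟩ := h (1 / 10) (by norm_num) (1 / 8) (by norm_num)
  set c : ℝ := min η (1 / 2) with hc
  have hc0 : 0 < c := lt_min hη (by norm_num)
  have hcη : c ≤ η := min_le_left _ _
  have hc2 : c ≤ 1 / 2 := min_le_right _ _
  set A : Set (EuclideanSpace ℝ (Fin 6)) := Set.range (sliceMap 0) ∪ Set.range (sliceMap c) with hA
  have hAN : A ⊆ {z : EuclideanSpace ℝ (Fin 6) | ∑ i : Fin 5, z (Fin.castSucc i) ^ 2 = 1} := by
    rintro z (⟨x, rfl⟩ | ⟨x, rfl⟩) <;> exact sum_sq_sliceMap _ x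
  have hAm : MeasurableSet A := (measurableSet_range_sliceMap 0).union (measurableSet_range_sliceMap c)
  have hsub : {z : EuclideanSpace ℝ (Fin 6) | ∑ i : Fin 5, z (Fin.castSucc i) ^ 2 = 1 ∧ z 5 = 0} ⊆ A := by
    rw [← range_sliceMap]
    exact Set.subset_union_left
  have hsep := separatesEnds_of_slice_subset hsub
  have hslab : ∀ z ∈ A, |z 5 - 0| ≤ η := by
    rintro z (⟨x, rfl⟩ | ⟨x, rfl⟩)
    · simp [sliceMap_apply_last, hη.le]
    · simpa [sliceMap_apply_last, abs_of_pos hc0] using hcη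
  have ht : (1 / 8 : ℝ) * Real.exp (2 * 0) ≤ Real.exp (2 * c) / 8 := by
    rw [mul_zero, Real.exp_zero, mul_one]
    have : (1 : ℝ) ≤ Real.exp (2 * c) := Real.one_le_exp (by linarith)
    linarith
  have key := H 0 A hAN hAm hsep hslab 0 (Real.exp (2 * c) / 8) ht
  rw [hA, Set.image_union, image_conformal_range_sliceMap, image_conformal_range_sliceMap, Real.exp_zero] at key
  have hdisj : Disjoint (Metric.sphere (0 : EuclideanSpace ℝ (Fin 5)) 1) (Metric.sphere (0 : EuclideanSpace ℝ (Fin 5)) (Real.exp c)) := by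
    refine Set.disjoint_left.2 fun x hx hx' => ?_
    rw [mem_sphere_zero_iff_norm] at hx hx'
    have h1 : c + 1 < Real.exp c := Real.add_one_lt_exp hc0.ne'
    linarith [hx, hx', h1]
  rw [gaussianArea_union_of_disjoint 4 (0 : EuclideanSpace ℝ (Fin 5)) _ isClosed_sphere.measurableSet hdisj,
    gaussianArea_sphere_exp_matched] at key
  have hΛ : gaussianEntropy 4 (Metric.sphere (0 : EuclideanSpace ℝ (Fin 5)) 1) ≠ ⊤ := by
    rw [gaussianEntropy_sphere_four (0 : EuclideanSpace ℝ (Fin 5)) one_pos]; exact ENNReal.ofReal_ne_top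
  have hlow : ENNReal.ofReal (1 / 10) < gaussianArea 4 (0 : EuclideanSpace ℝ (Fin 5)) (Real.exp (2 * c) / 8) (Metric.sphere (0 : EuclideanSpace ℝ (Fin 5)) 1) := by
    refine tenth_lt_gaussianArea_unitSphere ?_ ?_
    · have : (1 : ℝ) ≤ Real.exp (2 * c) := Real.one_le_exp (by linarith)
      linarith
    · have h3 : Real.exp (2 * c) ≤ Real.exp 1 := Real.exp_le_exp.2 (by linarith)
      have h1e : Real.exp 1 < 2.7182818286 := Real.exp_one_lt_d9
      linarith
  have key' : gaussianArea 4 (0 : EuclideanSpace ℝ (Fin 5)) (Real.exp (2 * c) / 8) (Metric.sphere (0 : EuclideanSpace ℝ (Fin 5)) 1) ≤ ENNReal.ofReal (1 / 10) := by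
    rw [add_comm] at key
    exact (ENNReal.add_le_add_iff_left hΛ).1 key
  exact absurd (hlow.trans_le key') (lt_irrefl _)

end Summit.SmoothPoincare4.SmoothPoincare4.Theorems.SliceIsolation.Negative

end
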